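import Literature.NumberTheory.PAdicHodge.SenOperator
import Literature.NumberTheory.PAdicHodge.BaseGaloisAction
import Literature.NumberTheory.PAdicHodge.BlochKatoDualExponential
import Literature.IUT.LogVolume.LogShellTopology
import Literature.NumberTheory.GaloisRepresentations.AbsGaloisGroup
import Mathlib.Topology.Algebra.OpenSubgroup
import Mathlib.FieldTheory.KrullTopology
import Mathlib.Analysis.Normed.Group.Ultra
import Mathlib.Analysis.SpecificLimits.Basic
import HarnessLib

/-!
# Tate–Sen: continuous additive `1`-cocycles are coboundaries under (TS1); `H¹_cont(H_F, ℂ_F) = 0`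
# granted the almost étale condition

Topic `Literature/NumberTheory/PAdicHodge`; companion of `TateInvariantsBase` / `TateTwistInvariants` /
`AxSenTate` (the `H⁰` half of Tate's theorems: `ℂ_F^{Γ_F} = F`, `ℂ_F(χ^j)^{Γ_F} = 0`) and of
`TateLogCyclotomicClass` (`[log χ] ≠ 0` in `H¹(Γ_F, ℂ_F)`). This file supplies the COHOMOLOGICAL ENGINE of the
`H¹` half — Tate's Prop. 10 / the additive case `d = 1` of Berger–Colmez's Lemme 3.2.1 and Cor. 3.2.2 — as
sorry-free theorems, with the number-theoretic input (Tate's Prop. 9: `F̄/F_∞` is almost étale, i.e. the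
Tate–Sen condition (TS1) of Berger–Colmez Déf. 3.1.3 for `ℂ_F`, their Prop. 4.1.1) DISPLAYED as a hypothesis.

* `TateSen.exists_eq_smul_sub_of_TS1` — ABSTRACT: a compact topological group `G` in which every neighbourhood
  of `1` contains an open subgroup, acting on a complete ultrametric normed field `C` by isometric ring
  automorphisms, continuously in the group variable, and satisfying (TS1) «there is `K` such that every open
  subgroup `U` admits a `U`-invariant `α` with `‖α‖ ≤ K` and `∑_{q ∈ G/U} q(α) = 1`» has
  `H¹_cont(G, C) = 0`: every continuous crossed homomorphism `c : G → C` is `g ↦ g b - b`.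
  Proof = `TateSen.step` (averaging against the trace-one element over coset representatives halves the bound
  of a cocycle at the cost of a coboundary of controlled norm) iterated, the corrections summed in `C`.
* `TateSen.continuous_smul_left` — the action map `σ ↦ σ • x`, `Γ_F → ℂ_F`, is continuous for every `x`
  (the group-variable continuity that `CompletedAlgClosure.lean` left out).
* `TateSen.kerCyclotomic_exists_eq_smul_sub_of_TS1` — the instance `G = H_F = ker χ_F` (tree
  `Sen.kerCyclotomic F p`, induced profinite topology), `C = ℂ_F`: **`H¹_cont(H_F, ℂ_F) = 0` granted (TS1) for
  `ℂ_F`**. With (TS1) (Tate 1967 §3.2 Prop. 9; a cite-only named fact is filed separately) this is brick (b2)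
  of the programme towards Kato, LNM 1553, II Prop. 1.2.3 (the tree's cite-only
  `cupLogInjective_and_hasDualExp_of_isDeRham` / `hasDualExp_of_isDeRham`): together with Tate's normalised-trace
  decomposition of `X = \widehat{F_∞}` (brick (b1)) it yields `H¹(Γ_F, ℂ_F(χ^j)) = 0` (`j ≠ 0`) and
  `H¹(Γ_F, ℂ_F) = F · [log χ]` by inflation–restriction.

Everything is proved; no named fact, no definition, no instance. NOT here: (TS1) itself (the different /
ramification estimate in the cyclotomic tower), (TS2)–(TS3) (Tate's normalised traces: `TateNormalizedTrace`),
the `GL_d` (non-abelian) version of Cor. 3.2.2, and the inflation–restriction assembly.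

## References

* L. Berger, P. Colmez, *Familles de représentations de de Rham et monodromie p-adique*, Astérisque 319 (2008),
  Déf. 3.1.3 (TS1), Lemme 3.2.1, Cor. 3.2.2, Prop. 4.1.1. [BergerColmez2008]
* J. Tate, *p-divisible groups* (1967), §3.2 Prop. 9, Prop. 10; §3.3. [Tate1967]
* J.-M. Fontaine, Y. Ouyang, *Theory of p-adic Galois representations*, §3.1–3.2. [FontaineOuyang2022]
-/

noncomputable section

open scoped Topology
open Filter

namespace Literature.NumberTheory.PAdicHodge.TateSen

/-! ### Abstract Tate–Sen vanishing under (TS1) -/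

section Abstract

variable {G : Type*} [Group G] {C : Type*} [NormedField C] [MulSemiringAction G C]

/-- A `1`-cocycle vanishes at `1`. [folklore] -/
private theorem cocycle_apply_one {c : G → C} (hc : ∀ g h : G, c (g * h) = c g + g • c h) : c 1 = 0 := by
  have h := hc 1 1
  rw [mul_one, one_smul] at h
  exact left_eq_add.mp h

/-- Coboundaries are cocycles; the difference of a cocycle and a coboundary is a cocycle. [folklore] -/
private theorem cocycle_sub_coboundary {c : G → C} (hc : ∀ g h : G, c (g * h) = c g + g • c h) (b : C) :
    ∀ g h : G, (c (g * h) - ((g * h) • b - b)) = (c g - (g • b - b)) + g • (c h - (h • b - b)) := by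
  intro g h
  rw [hc g h, mul_smul, smul_sub, smul_sub]
  abel

/-- An isometric action is continuous in the module variable. [folklore] -/
private theorem continuous_constSMul_of_norm_smul (hiso : ∀ (g : G) (x : C), ‖g • x‖ = ‖x‖) (g : G) :
    Continuous fun x : C => g • x := by
  refine (Isometry.of_dist_eq fun x y => ?_).continuous
  rw [dist_eq_norm, dist_eq_norm, ← smul_sub, hiso]

variable [TopologicalSpace G] [IsTopologicalGroup G] [CompactSpace G] [IsUltrametricDist C]

/-- **One step of the Tate–Sen approximation** (Berger–Colmez 2008, Lemme 3.2.1, additive case `d = 1`):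
a continuous cocycle bounded by `s` is, up to a coboundary `∂b` with `‖b‖ ≤ K s`, bounded by `s / 2`.
[cite: BergerColmez2008, Lemme 3.2.1] -/
theorem step (hiso : ∀ (g : G) (x : C), ‖g • x‖ = ‖x‖)
    (hbasis : ∀ V ∈ 𝓝 (1 : G), ∃ U : OpenSubgroup G, (U : Set G) ⊆ V)
    {K : ℝ} (hK : 1 ≤ K)
    (hTS : ∀ U : OpenSubgroup G, ∃ α : C, (∀ u ∈ U, u • α = α) ∧ ‖α‖ ≤ K ∧
      ∑ᶠ q : G ⧸ U.toSubgroup, q.out • α = 1)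
    {c : G → C} (hc : ∀ g h : G, c (g * h) = c g + g • c h) (hcont : Continuous c)
    {s : ℝ} (hs : 0 < s) (hbd : ∀ g, ‖c g‖ ≤ s) :
    ∃ b : C, ‖b‖ ≤ K * s ∧ ∀ g, ‖c g - (g • b - b)‖ ≤ s / 2 := by
  have hK0 : 0 < K := lt_of_lt_of_le one_pos hK
  set δ : ℝ := s / (2 * K) with hδ
  have hδ0 : 0 < δ := div_pos hs (by positivity)
  -- an open subgroup on which `c` is `δ`-small
  have hV : c ⁻¹' Metric.ball 0 δ ∈ 𝓝 (1 : G) := by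
    refine (Metric.isOpen_ball.preimage hcont).mem_nhds ?_
    rw [Set.mem_preimage, cocycle_apply_one hc]
    exact Metric.mem_ball_self hδ0
  obtain ⟨U, hU⟩ := hbasis _ hV
  have hUδ : ∀ u ∈ U, ‖c u‖ < δ := fun u hu => by
    have := hU hu
    rwa [Set.mem_preimage, mem_ball_zero_iff] at this
  obtain ⟨α, hαU, hαK, hαtr⟩ := hTS U
  haveI : Fintype (G ⧸ U.toSubgroup) := Fintype.ofFinite _
  rw [finsum_eq_sum_of_fintype] at hαtr
  -- the averaging element
  refine ⟨-∑ q : G ⧸ U.toSubgroup, c q.out * q.out • α, ?_, fun h => ?_⟩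
  · rw [norm_neg]
    refine IsUltrametricDist.norm_sum_le_of_forall_le_of_nonneg (by positivity) fun q _ => ?_
    rw [norm_mul, hiso, mul_comm]
    exact mul_le_mul hαK (hbd _) (norm_nonneg _) hK0.le
  · -- coset bookkeeping: `(h • q).out = h * q.out * u_q` with `u_q ∈ U`
    have hex : ∀ q : G ⧸ U.toSubgroup, ∃ u : U.toSubgroup, (h • q).out = h * q.out * u := by
      intro q
      have hq : h • q = (QuotientGroup.mk (h * q.out) : G ⧸ U.toSubgroup) := by
        conv_lhs => rw [← QuotientGroup.out_eq' q]
        rfl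
      rw [hq]
      exact QuotientGroup.mk_out_eq_mul U.toSubgroup (h * q.out)
    choose u hu using hex
    have hfix : ∀ q : G ⧸ U.toSubgroup, (h * q.out) • α = (h • q).out • α := by
      intro q
      have h1 : h * q.out = (h • q).out * ((u q : G)⁻¹) := by
        rw [hu q, mul_inv_cancel_right]
      rw [h1, mul_smul, hαU _ (U.toSubgroup.inv_mem (u q).2)]
    have hcoc : ∀ q : G ⧸ U.toSubgroup,
        c (h * q.out) = c (h • q).out + (h • q).out • c ((u q : G)⁻¹) := by
      intro q
      have h1 : h * q.out = (h • q).out * ((u q : G)⁻¹) := by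
        rw [hu q, mul_inv_cancel_right]
      rw [h1, hc]
    -- reindexing along `q ↦ h • q`
    have hre1 : ∑ q : G ⧸ U.toSubgroup, c (h • q).out * (h • q).out • α =
        ∑ q : G ⧸ U.toSubgroup, c q.out * q.out • α :=
      Fintype.sum_equiv (MulAction.toPerm h) _ _ fun q => rfl
    have hre2 : ∑ q : G ⧸ U.toSubgroup, (h • q).out • α = 1 := by
      rw [← hαtr]
      exact Fintype.sum_equiv (MulAction.toPerm h) _ _ fun q => rfl
    -- the error term
    have key : c h - (h • (-∑ q : G ⧸ U.toSubgroup, c q.out * q.out • α) -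
          -∑ q : G ⧸ U.toSubgroup, c q.out * q.out • α) =
        ∑ q : G ⧸ U.toSubgroup, ((h • q).out • c ((u q : G)⁻¹)) * (h • q).out • α := by
      have hsmul : h • (∑ q : G ⧸ U.toSubgroup, c q.out * q.out • α) =
          ∑ q : G ⧸ U.toSubgroup, (c (h • q).out + (h • q).out • c ((u q : G)⁻¹) - c h) *
            (h • q).out • α := by
        rw [Finset.smul_sum]
        refine Finset.sum_congr rfl fun q _ => ?_
        rw [smul_mul', ← mul_smul, hfix q, ← hcoc q]
        congr 1
        rw [hc h q.out]
        abel
      rw [smul_neg, hsmul]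
      have hsplit : ∑ q : G ⧸ U.toSubgroup, (c (h • q).out + (h • q).out • c ((u q : G)⁻¹) - c h) *
            (h • q).out • α =
          ∑ q : G ⧸ U.toSubgroup, c (h • q).out * (h • q).out • α +
            ∑ q : G ⧸ U.toSubgroup, ((h • q).out • c ((u q : G)⁻¹)) * (h • q).out • α -
            c h * ∑ q : G ⧸ U.toSubgroup, (h • q).out • α := by
        rw [Finset.mul_sum, ← Finset.sum_add_distrib, ← Finset.sum_sub_distrib]
        refine Finset.sum_congr rfl fun q _ => ?_
        ring
      rw [hsplit, hre1, hre2, mul_one]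
      abel
    rw [key]
    refine IsUltrametricDist.norm_sum_le_of_forall_le_of_nonneg (by positivity) fun q _ => ?_
    rw [norm_mul, hiso, hiso]
    have hu' : ‖c ((u q : G)⁻¹)‖ < δ := hUδ _ (U.toSubgroup.inv_mem (u q).2)
    calc ‖c ((u q : G)⁻¹)‖ * ‖α‖ ≤ δ * K :=
          mul_le_mul hu'.le hαK (norm_nonneg _) hδ0.le
      _ = s / 2 := by rw [hδ]; field_simp

variable [CompleteSpace C]

/-- **Tate–Sen: continuous additive `1`-cocycles of a group satisfying (TS1) are coboundaries**
(Berger–Colmez 2008, Cor. 3.2.2, additive case `d = 1`; Tate 1967 §3.2). Let the compact group `G`, in which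
every neighbourhood of `1` contains an open subgroup, act on the complete ultrametric normed field `C` by
isometric ring automorphisms, continuously in the group variable, and assume the Tate–Sen condition (TS1):
for some constant `K` every open subgroup `U` admits an `U`-invariant `α ∈ C` with `‖α‖ ≤ K` and
`∑_{q ∈ G/U} q(α) = 1`. Then every continuous `1`-cocycle `c : G → C` (`c(gh) = c(g) + g c(h)`) is a
coboundary: `c(g) = g b - b` for some `b ∈ C`. Proof: iterate `step` (each time halving the bound at the
cost of a correction of norm `≤ K ×` bound) and sum the corrections (geometric series, `C` complete).
[cite: BergerColmez2008, Lemme 3.2.1 and Cor. 3.2.2] [cite: Tate1967, §3.2 Prop. 9 and Prop. 10] -/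
theorem exists_eq_smul_sub_of_TS1 (hiso : ∀ (g : G) (x : C), ‖g • x‖ = ‖x‖)
    (hcontG : ∀ x : C, Continuous fun g : G => g • x)
    (hbasis : ∀ V ∈ 𝓝 (1 : G), ∃ U : OpenSubgroup G, (U : Set G) ⊆ V)
    (hTS : ∃ K : ℝ, ∀ U : OpenSubgroup G, ∃ α : C, (∀ u ∈ U, u • α = α) ∧ ‖α‖ ≤ K ∧
      ∑ᶠ q : G ⧸ U.toSubgroup, q.out • α = 1)
    (c : G → C) (hc : ∀ g h : G, c (g * h) = c g + g • c h) (hcont : Continuous c) :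
    ∃ b : C, ∀ g, c g = g • b - b := by
  obtain ⟨K₀, hK₀⟩ := hTS
  -- enlarge the constant to `K ≥ 1`
  set K : ℝ := max K₀ 1 with hKdef
  have hK : 1 ≤ K := le_max_right _ _
  have hK0 : 0 < K := lt_of_lt_of_le one_pos hK
  have hTS' : ∀ U : OpenSubgroup G, ∃ α : C, (∀ u ∈ U, u • α = α) ∧ ‖α‖ ≤ K ∧
      ∑ᶠ q : G ⧸ U.toSubgroup, q.out • α = 1 := fun U => by
    obtain ⟨α, h1, h2, h3⟩ := hK₀ U
    exact ⟨α, h1, h2.trans (le_max_left _ _), h3⟩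
  -- an initial bound `r > 0`
  obtain ⟨R, hR⟩ : ∃ R : ℝ, ∀ g, ‖c g‖ ≤ R := by
    obtain ⟨R, hR⟩ := (isCompact_univ.image hcont).isBounded.exists_norm_le
    exact ⟨R, fun g => hR _ ⟨g, Set.mem_univ _, rfl⟩⟩
  set r : ℝ := max R 1 with hrdef
  have hr : 0 < r := lt_of_lt_of_le one_pos (le_max_right _ _)
  have hbd0 : ∀ g, ‖c g‖ ≤ r * (1 / 2) ^ 0 := fun g => by
    rw [pow_zero, mul_one]; exact (hR g).trans (le_max_left _ _)
  -- the predicate carried along the iteration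
  let P : ℕ → (G → C) → Prop := fun k c' =>
    (∀ g h : G, c' (g * h) = c' g + g • c' h) ∧ Continuous c' ∧ ∀ g, ‖c' g‖ ≤ r * (1 / 2) ^ k
  -- one step, in the form needed for the recursion
  have hstep : ∀ (k : ℕ) (c' : {c' : G → C // P k c'}), ∃ b : C, ‖b‖ ≤ K * (r * (1 / 2) ^ k) ∧
      P (k + 1) (fun g => c'.1 g - (g • b - b)) := by
    rintro k ⟨c', hc'1, hc'2, hc'3⟩
    obtain ⟨b, hb1, hb2⟩ := step hiso hbasis hK hTS' hc'1 hc'2 (by positivity) hc'3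
    refine ⟨b, hb1, cocycle_sub_coboundary hc'1 b, ?_, fun g => ?_⟩
    · exact hc'2.sub ((hcontG b).sub continuous_const)
    · refine (hb2 g).trans (le_of_eq ?_)
      rw [pow_succ]; ring
  choose bOf hbOf using hstep
  -- the sequence of corrected cocycles and of corrections
  let seq : (k : ℕ) → {c' : G → C // P k c'} := fun k =>
    Nat.rec (motive := fun k => {c' : G → C // P k c'}) ⟨c, hc, hcont, hbd0⟩
      (fun k prev => ⟨fun g => prev.1 g - (g • bOf k prev - bOf k prev), (hbOf k prev).2⟩) k
  let bseq : ℕ → C := fun k => bOf k (seq k)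
  have hseq_succ : ∀ k g, (seq (k + 1)).1 g = (seq k).1 g - (g • bseq k - bseq k) := fun k g => rfl
  have hbseq : ∀ k, ‖bseq k‖ ≤ K * r * (1 / 2) ^ k := fun k => by
    have := (hbOf k (seq k)).1
    rw [mul_assoc]; exact this
  -- partial sums
  have hpartial : ∀ (n : ℕ) (g : G), (seq n).1 g =
      c g - (g • (∑ k ∈ Finset.range n, bseq k) - ∑ k ∈ Finset.range n, bseq k) := by
    intro n g
    induction n with
    | zero => simp [seq]
    | succ n ih =>
      rw [hseq_succ, ih, Finset.sum_range_succ, smul_add]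
      abel
  -- summability of the corrections
  have hsum : Summable bseq := by
    refine Summable.of_norm_bounded (g := fun k => K * r * (1 / 2 : ℝ) ^ k) ?_ hbseq
    exact (summable_geometric_two).mul_left (K * r) |>.congr fun k => by ring
  refine ⟨∑' k, bseq k, fun g => ?_⟩
  -- pass to the limit in `(seq n) g = c g - (g • S_n - S_n)`, `‖(seq n) g‖ ≤ r 2^{-n}`
  have hlim1 : Tendsto (fun n => ∑ k ∈ Finset.range n, bseq k) atTop (𝓝 (∑' k, bseq k)) :=
    hsum.hasSum.tendsto_sum_nat
  have hlim2 : Tendsto (fun n => c g - (g • (∑ k ∈ Finset.range n, bseq k) - ∑ k ∈ Finset.range n, bseq k))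
      atTop (𝓝 (c g - (g • (∑' k, bseq k) - ∑' k, bseq k))) :=
    tendsto_const_nhds.sub ((((continuous_constSMul_of_norm_smul hiso g).tendsto _).comp hlim1).sub hlim1)
  have hgeo : Tendsto (fun n : ℕ => r * (1 / 2 : ℝ) ^ n) atTop (𝓝 0) := by
    have h := (tendsto_pow_atTop_nhds_zero_of_lt_one (by norm_num : (0 : ℝ) ≤ 1 / 2)
      (by norm_num : (1 / 2 : ℝ) < 1)).const_mul r
    rwa [mul_zero] at h
  have hlim3 : Tendsto (fun n => c g - (g • (∑ k ∈ Finset.range n, bseq k) - ∑ k ∈ Finset.range n, bseq k))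
      atTop (𝓝 0) :=
    squeeze_zero_norm (fun n => by rw [← hpartial]; exact (seq n).2.2.2 g) hgeo
  have := tendsto_nhds_unique hlim2 hlim3
  exact (sub_eq_zero.mp this)

end Abstract

/-! ### The case of `H_F = ker χ_F ≤ Γ_F` acting on `ℂ_F` -/

section AbsoluteGalois

open UniformSpace Field
open Literature.NumberTheory.GaloisRepresentations

variable {F : Type} [Field F] [ValuativeRel F] [TopologicalSpace F] [IsNonarchimedeanLocalField F]

/-- The stabiliser in `Γ_F` of an element of `F̄` is open (Krull topology; Mathlib's
`stabilizer_isOpen_of_isIntegral`, transported to the normed synonym `NormedAlgClosure F`). [folklore] -/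
private theorem isOpen_stabilizer_normedAlgClosure (x : NormedAlgClosure F) :
    IsOpen (MulAction.stabilizer (absoluteGaloisGroup F) x : Set (absoluteGaloisGroup F)) :=
  stabilizer_isOpen_of_isIntegral (K := F) (L := AlgebraicClosure F) (NormedAlgClosure.toAlgClosure x)

/-- **The action map `Γ_F → ℂ_F`, `σ ↦ σ • x`, is continuous** for every `x ∈ ℂ_F` (continuity of the
action in the GROUP variable, complementing `CompletedAlgClosure.continuous_constSMul`): on `F̄` the map is
locally constant (open stabilisers), and `F̄` is dense in `ℂ_F` on which `Γ_F` acts by isometries.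
[cite: Tate1967, §3.1] [cite: FontaineOuyang2022, §3.1] -/
theorem continuous_smul_left (x : CompletedAlgClosure F) :
    Continuous fun σ : absoluteGaloisGroup F => σ • x := by
  rw [Metric.continuous_iff']
  intro σ₀ ε hε
  obtain ⟨y, hy⟩ : ∃ y : NormedAlgClosure F, dist x (y : CompletedAlgClosure F) < ε :=
    Metric.mem_closure_range_iff.mp (CompletedAlgClosure.denseRange_coe x) ε hε
  have hopen : IsOpen {σ : absoluteGaloisGroup F | σ • y ∈ ({σ₀ • y} : Set (NormedAlgClosure F))} :=
    isOpen_setOf_smul_mem_of_isOpen_stabilizer y (isOpen_stabilizer_normedAlgClosure y) _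
  have hmem : σ₀ ∈ {σ : absoluteGaloisGroup F | σ • y ∈ ({σ₀ • y} : Set (NormedAlgClosure F))} :=
    Set.mem_singleton _
  filter_upwards [hopen.mem_nhds hmem] with σ hσ
  have hσ' : σ • y = σ₀ • y := hσ
  have hxy : ‖x - (y : CompletedAlgClosure F)‖ < ε := by rwa [← dist_eq_norm]
  calc dist (σ • x) (σ₀ • x)
        = ‖σ • (x - (y : CompletedAlgClosure F)) + σ₀ • ((y : CompletedAlgClosure F) - x)‖ := by
          rw [dist_eq_norm, smul_sub, smul_sub, CompletedAlgClosure.smul_coe σ y, hσ',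
            ← CompletedAlgClosure.smul_coe σ₀ y]
          abel_nf
    _ ≤ max ‖σ • (x - (y : CompletedAlgClosure F))‖ ‖σ₀ • ((y : CompletedAlgClosure F) - x)‖ :=
          IsUltrametricDist.norm_add_le_max _ _
    _ < ε := by
          rw [CompletedAlgClosure.norm_smul, CompletedAlgClosure.norm_smul, norm_sub_rev _ x, max_self]
          exact hxy

omit [ValuativeRel F] [TopologicalSpace F] [IsNonarchimedeanLocalField F] in
/-- Every neighbourhood of `1` in a subgroup `H ≤ Γ_F` (induced Krull topology) contains an open subgroup of
`H` (namely `H ∩ Gal(F̄/E)` for a finite extension `E/F`). [folklore] -/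
private theorem exists_openSubgroup_subset (H : Subgroup (absoluteGaloisGroup F)) {V : Set H} (hV : V ∈ 𝓝 (1 : H)) :
    ∃ U : OpenSubgroup H, (U : Set H) ⊆ V := by
  obtain ⟨W, hW, hWV⟩ := (mem_nhds_subtype _ _ _).mp hV
  rw [OneMemClass.coe_one] at hW
  obtain ⟨E, hfin, hE⟩ := (krullTopology_mem_nhds_one_iff F (AlgebraicClosure F) W).mp hW
  haveI := hfin
  refine ⟨⟨E.fixingSubgroup.subgroupOf H, Subgroup.subgroupOf_isOpen H _ E.fixingSubgroup_isOpen⟩, ?_⟩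
  intro h hh
  exact hWV (hE (Subgroup.mem_subgroupOf.mp hh))

variable (p : ℕ) [Fact p.Prime]

omit [ValuativeRel F] [TopologicalSpace F] [IsNonarchimedeanLocalField F] in
/-- `H_F = ker χ_F` is closed in `Γ_F` (the cyclotomic character is continuous). [folklore] -/
private theorem isClosed_kerCyclotomic :
    IsClosed ((Sen.kerCyclotomic F p : Subgroup (absoluteGaloisGroup F)) : Set (absoluteGaloisGroup F)) := by
  have h : ((Sen.kerCyclotomic F p : Subgroup (absoluteGaloisGroup F)) : Set (absoluteGaloisGroup F)) =
      (GaloisRep.cyclotomicCharacter F p) ⁻¹' {1} := by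
    ext σ
    exact Sen.mem_kerCyclotomic_iff σ
  rw [h]
  exact isClosed_singleton.preimage (GaloisRep.cyclotomicCharacter F p).continuous

variable [CharZero F]

/-- **`H¹_cont(H_F, ℂ_F) = 0` GRANTED the Tate–Sen condition (TS1) for `ℂ_F`** (Berger–Colmez 2008, Cor. 3.2.2
additive case, with Prop. 4.1.1 = Tate 1967 §3.2 Prop. 9 as the displayed hypothesis `hTS`): for the
non-archimedean local field `F` of characteristic `0`, `H_F = ker χ_F = Gal(F̄/F(μ_{p^∞}))` (tree
`Sen.kerCyclotomic F p`, induced profinite topology) and `ℂ_F = CompletedAlgClosure F`, IF for some `K` every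
open subgroup `U ≤ H_F` admits a `U`-invariant `α ∈ ℂ_F` with `‖α‖ ≤ K` and `∑_{τ ∈ H_F/U} τ(α) = 1`, THEN every
continuous `1`-cocycle `c : H_F → ℂ_F` is a coboundary, `c(g) = g b - b`. This is brick (b2) of the programme
towards Kato, LNM 1553, II Prop. 1.2.3 (`cupLogInjective_and_hasDualExp_of_isDeRham`) with its number-theoretic
input (almost étaleness of `F̄/F_∞`) displayed. [cite: BergerColmez2008, Lemme 3.2.1, Cor. 3.2.2 and Prop. 4.1.1]
[cite: Tate1967, §3.2 Prop. 9 and Prop. 10] -/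
theorem kerCyclotomic_exists_eq_smul_sub_of_TS1
    (hTS : ∃ K : ℝ, ∀ U : OpenSubgroup (Sen.kerCyclotomic F p), ∃ α : CompletedAlgClosure F,
      (∀ u ∈ U, u • α = α) ∧ ‖α‖ ≤ K ∧
        ∑ᶠ q : (Sen.kerCyclotomic F p) ⧸ U.toSubgroup, q.out • α = 1)
    (c : Sen.kerCyclotomic F p → CompletedAlgClosure F)
    (hc : ∀ g h : Sen.kerCyclotomic F p, c (g * h) = c g + g • c h) (hcont : Continuous c) :
    ∃ b : CompletedAlgClosure F, ∀ g : Sen.kerCyclotomic F p, c g = g • b - b := by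
  haveI : CompactSpace (Sen.kerCyclotomic F p) :=
    isCompact_iff_compactSpace.mp (isClosed_kerCyclotomic (F := F) p).isCompact
  refine exists_eq_smul_sub_of_TS1 (G := Sen.kerCyclotomic F p) (C := CompletedAlgClosure F)
    (fun g x => CompletedAlgClosure.norm_smul (g : absoluteGaloisGroup F) x)
    (fun x => (continuous_smul_left x).comp continuous_subtype_val)
    (fun V hV => exists_openSubgroup_subset _ hV) hTS c hc hcont

end AbsoluteGalois

/-! ### The case of `H₀ = ker χ ≤ G₀ = Gal(F̄/ℚ_p)` acting on `ℂ_F` (the base of Tate's tower) -/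

section BaseGalois

open UniformSpace Field ValuativeRel
open Literature.NumberTheory.GaloisRepresentations.IsNonarchimedeanLocalField
open Literature.NumberTheory.GaloisRepresentations

variable {F : Type} [Field F] [ValuativeRel F] [TopologicalSpace F] [IsNonarchimedeanLocalField F]
  [CharZero F] {p : ℕ} [Fact p.Prime] (hp : valuation F p < 1)

/-- **The action map `G₀ → ℂ_F`, `g ↦ g • x`, is continuous** for every `x ∈ ℂ_F`, `G₀ = Gal(F̄/K₀)` the
Galois group over the base `K₀ = PadicBase F p hp ≅ ℚ_p` (tree `BaseGaloisGroup hp`, Krull topology, action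
`CompletedAlgClosure.instBaseAction`): open stabilisers on `F̄`, density of `F̄` in `ℂ_F`, isometric action.
[cite: Tate1967, §3.1] [cite: FontaineOuyang2022, §3.1] -/
theorem continuous_base_smul_left (x : CompletedAlgClosure F) :
    Continuous fun g : BaseGaloisGroup hp => g • x := by
  rw [Metric.continuous_iff']
  intro σ₀ ε hε
  obtain ⟨y, hy⟩ : ∃ y : NormedAlgClosure F, dist x (y : CompletedAlgClosure F) < ε :=
    Metric.mem_closure_range_iff.mp (CompletedAlgClosure.denseRange_coe x) ε hε
  have hstab : IsOpen (MulAction.stabilizer (BaseGaloisGroup hp) y : Set (BaseGaloisGroup hp)) :=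
    stabilizer_isOpen_of_isIntegral (K := PadicBase F p hp) (L := NormedAlgClosure F) y
  have hopen : IsOpen {σ : BaseGaloisGroup hp | σ • y ∈ ({σ₀ • y} : Set (NormedAlgClosure F))} :=
    isOpen_setOf_smul_mem_of_isOpen_stabilizer y hstab _
  have hmem : σ₀ ∈ {σ : BaseGaloisGroup hp | σ • y ∈ ({σ₀ • y} : Set (NormedAlgClosure F))} :=
    Set.mem_singleton _
  filter_upwards [hopen.mem_nhds hmem] with σ hσ
  have hσ' : σ • y = σ₀ • y := hσ
  have hxy : ‖x - (y : CompletedAlgClosure F)‖ < ε := by rwa [← dist_eq_norm]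
  calc dist (σ • x) (σ₀ • x)
        = ‖σ • (x - (y : CompletedAlgClosure F)) + σ₀ • ((y : CompletedAlgClosure F) - x)‖ := by
          rw [dist_eq_norm, smul_sub, smul_sub, CompletedAlgClosure.base_smul_coe hp σ y, hσ',
            ← CompletedAlgClosure.base_smul_coe hp σ₀ y]
          abel_nf
    _ ≤ max ‖σ • (x - (y : CompletedAlgClosure F))‖ ‖σ₀ • ((y : CompletedAlgClosure F) - x)‖ :=
          IsUltrametricDist.norm_add_le_max _ _
    _ < ε := by
          rw [CompletedAlgClosure.norm_base_smul, CompletedAlgClosure.norm_base_smul, norm_sub_rev _ x,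
            max_self]
          exact hxy

omit [ValuativeRel F] [TopologicalSpace F] [IsNonarchimedeanLocalField F] [CharZero F] [Fact p.Prime] in
/-- Every neighbourhood of `1` in a subgroup `H` of a Galois group `Gal(L/K)` (induced Krull topology) contains
an open subgroup of `H` (namely `H ∩ Gal(L/E)` for a finite `E/K`). [folklore] -/
private theorem exists_openSubgroup_subset_gal {K L : Type*} [Field K] [Field L] [Algebra K L]
    (H : Subgroup (L ≃ₐ[K] L)) {V : Set H} (hV : V ∈ 𝓝 (1 : H)) :
    ∃ U : OpenSubgroup H, (U : Set H) ⊆ V := by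
  obtain ⟨W, hW, hWV⟩ := (mem_nhds_subtype _ _ _).mp hV
  rw [OneMemClass.coe_one] at hW
  obtain ⟨E, hfin, hE⟩ := (krullTopology_mem_nhds_one_iff K L W).mp hW
  haveI := hfin
  refine ⟨⟨E.fixingSubgroup.subgroupOf H, Subgroup.subgroupOf_isOpen H _ E.fixingSubgroup_isOpen⟩, ?_⟩
  intro h hh
  exact hWV (hE (Subgroup.mem_subgroupOf.mp hh))

/-- `H₀ = ker χ` is closed in `G₀` (the cyclotomic character of `Gal(F̄/K₀)` is continuous, Mathlib's
`cyclotomicCharacter.continuous`). [folklore] -/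
private theorem isClosed_baseKer :
    IsClosed (((BaseGaloisGroup.baseCyclotomicCharacter hp).ker : Subgroup (BaseGaloisGroup hp)) :
      Set (BaseGaloisGroup hp)) := by
  have h : (((BaseGaloisGroup.baseCyclotomicCharacter hp).ker : Subgroup (BaseGaloisGroup hp)) :
      Set (BaseGaloisGroup hp)) = (BaseGaloisGroup.baseCyclotomicCharacter hp) ⁻¹' {1} := by
    ext g
    exact MonoidHom.mem_ker
  rw [h]
  exact isClosed_singleton.preimage
    (cyclotomicCharacter.continuous p (PadicBase F p hp) (NormedAlgClosure F))

/-- **`H¹_cont(H₀, ℂ_F) = 0` GRANTED (TS1), at the base of Tate's tower**: for `G₀ = Gal(F̄/K₀)`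
(`K₀ = PadicBase F p hp ≅ ℚ_p`, tree `BaseGaloisGroup hp`), `H₀ = ker χ = Gal(F̄/K₀(μ_{p^∞}))`
(`(baseCyclotomicCharacter hp).ker`, induced profinite topology) acting on `ℂ_F` — IF for some `K` every open
subgroup `U ≤ H₀` admits a `U`-invariant `α ∈ ℂ_F` with `‖α‖ ≤ K` and `∑_{q ∈ H₀/U} q(α) = 1` (Berger–Colmez's
(TS1) for `Λ̃ = ℂ_p`, their Prop. 4.1.1 = Tate 1967 §3.2 Prop. 9, displayed as `hTS`), THEN every continuous
`1`-cocycle `c : H₀ → ℂ_F` is a coboundary. This is the form consumed by the `G₀`-level assembly of Tate's `H¹`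
theorems over the tower `K₀(μ_{p^∞})` (tree `TateTrace`, `TateDescent`). [cite: BergerColmez2008, Lemme 3.2.1, Cor. 3.2.2 and Prop. 4.1.1]
[cite: Tate1967, §3.2 Prop. 9 and Prop. 10] -/
theorem baseKer_exists_eq_smul_sub_of_TS1
    (hTS : ∃ K : ℝ, ∀ U : OpenSubgroup (BaseGaloisGroup.baseCyclotomicCharacter hp).ker,
      ∃ α : CompletedAlgClosure F, (∀ u ∈ U, u • α = α) ∧ ‖α‖ ≤ K ∧
        ∑ᶠ q : (BaseGaloisGroup.baseCyclotomicCharacter hp).ker ⧸ U.toSubgroup, q.out • α = 1)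
    (c : (BaseGaloisGroup.baseCyclotomicCharacter hp).ker → CompletedAlgClosure F)
    (hc : ∀ g h : (BaseGaloisGroup.baseCyclotomicCharacter hp).ker, c (g * h) = c g + g • c h)
    (hcont : Continuous c) :
    ∃ b : CompletedAlgClosure F, ∀ g : (BaseGaloisGroup.baseCyclotomicCharacter hp).ker, c g = g • b - b := by
  haveI : IsGalois (PadicBase F p hp) (NormedAlgClosure F) := inferInstance
  haveI : CompactSpace (BaseGaloisGroup.baseCyclotomicCharacter hp).ker :=
    isCompact_iff_compactSpace.mp (isClosed_baseKer hp).isCompact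
  refine exists_eq_smul_sub_of_TS1 (G := (BaseGaloisGroup.baseCyclotomicCharacter hp).ker)
    (C := CompletedAlgClosure F)
    (fun g x => CompletedAlgClosure.norm_base_smul hp (g : BaseGaloisGroup hp) x)
    (fun x => (continuous_base_smul_left hp x).comp continuous_subtype_val)
    (fun V hV => exists_openSubgroup_subset_gal _ hV) hTS c hc hcont

end BaseGalois

/-! ### From (TS1) at the base of the tower to `H¹_cont(H_F, ℂ_F) = 0` over `F` -/

section Descent

open UniformSpace Field ValuativeRel
open Literature.NumberTheory.GaloisRepresentations
open Literature.NumberTheory.GaloisRepresentations.IsNonarchimedeanLocalField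

variable {F : Type} [Field F] [ValuativeRel F] [TopologicalSpace F] [IsNonarchimedeanLocalField F]
  [CharZero F] (p : ℕ) [Fact p.Prime] (hp : valuation F p < 1)

/-- The embedding `H_F = ker χ_F → H₀ = ker χ`, `h ↦ toBase h` (`χ(toBase σ) = χ_F(σ)`), as a group
homomorphism between the subgroup types; a private packaging of `BaseGaloisGroup.toBase`. [folklore] -/
private theorem toBase_mem_baseKer (h : Sen.kerCyclotomic F p) :
    BaseGaloisGroup.toBase hp (h : absoluteGaloisGroup F) ∈ (BaseGaloisGroup.baseCyclotomicCharacter hp).ker := by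
  rw [MonoidHom.mem_ker, BaseGaloisGroup.baseCyclotomicCharacter_toBase]
  exact (Sen.mem_kerCyclotomic_iff (h : absoluteGaloisGroup F)).mp h.2

/-- **`H¹_cont(H_F, ℂ_F) = 0` over `F`, GRANTED (TS1) at the base of the tower in Berger–Colmez's general form**
(pairs of open subgroups `H₁ ≤ H₂ ≤ H₀ = ker χ ≤ Gal(F̄/K₀)`, every system of representatives): for the
non-archimedean local field `F` of characteristic `0` and residue characteristic `p` and `H_F = ker χ_F ≤ Γ_F`
(tree `Sen.kerCyclotomic F p`), every continuous `1`-cocycle `c : H_F → ℂ_F` is a coboundary. Proof: transport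
(TS1) along the closed embedding `toBase : Γ_F → G₀` (`H_F ↦` an open subgroup of `H₀`, the elements of `H₀` fixing
`F`; open subgroups of `H_F` `↦` open subgroups of `H₀`, by the Krull neighbourhood bases on both sides and
`BaseGaloisGroup.exists_toBase_eq`), then `kerCyclotomic_exists_eq_smul_sub_of_TS1`. This is Tate 1967 §3.2
Prop. 10 for the field `F` with Prop. 9 (in the form (TS1) for `K₀ ≅ ℚ_p`, Berger–Colmez Prop. 4.1.1) displayed.
[cite: Tate1967, §3.2 Prop. 9 and Prop. 10] [cite: BergerColmez2008, Déf. 3.1.3 (TS1), Cor. 3.2.2 and Prop. 4.1.1] -/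
theorem kerCyclotomic_exists_eq_smul_sub_of_baseTS1
    (hTS : ∃ K : ℝ, ∀ (H₁ H₂ : OpenSubgroup (BaseGaloisGroup.baseCyclotomicCharacter hp).ker), H₁ ≤ H₂ →
      ∀ S : Finset (BaseGaloisGroup.baseCyclotomicCharacter hp).ker,
        (∀ s ∈ S, s ∈ H₂) → (∀ h ∈ H₂, ∃! s, s ∈ S ∧ s⁻¹ * h ∈ H₁) →
        ∃ α : CompletedAlgClosure F, (∀ u ∈ H₁, u • α = α) ∧ ‖α‖ ≤ K ∧ ∑ s ∈ S, s • α = 1)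
    (c : Sen.kerCyclotomic F p → CompletedAlgClosure F)
    (hc : ∀ g h : Sen.kerCyclotomic F p, c (g * h) = c g + g • c h) (hcont : Continuous c) :
    ∃ b : CompletedAlgClosure F, ∀ g : Sen.kerCyclotomic F p, c g = g • b - b := by
  classical
  -- notation
  set H₀ : Subgroup (BaseGaloisGroup hp) := (BaseGaloisGroup.baseCyclotomicCharacter hp).ker with hH₀
  haveI : CompactSpace (Sen.kerCyclotomic F p) :=
    isCompact_iff_compactSpace.mp (isClosed_kerCyclotomic (F := F) p).isCompact
  -- the embedding `j : H_F →* H₀`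
  let j : Sen.kerCyclotomic F p →* H₀ :=
    { toFun := fun h => ⟨BaseGaloisGroup.toBase hp (h : absoluteGaloisGroup F), toBase_mem_baseKer p hp h⟩
      map_one' := by ext1; simp
      map_mul' := fun a b => by ext1; simp }
  have hj : ∀ h : Sen.kerCyclotomic F p, ((j h : H₀) : BaseGaloisGroup hp) =
      BaseGaloisGroup.toBase hp (h : absoluteGaloisGroup F) := fun h => rfl
  have hjinj : Function.Injective j := by
    intro a b hab
    have h1 : BaseGaloisGroup.toBase hp (a : absoluteGaloisGroup F) = BaseGaloisGroup.toBase hp b := by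
      rw [← hj, ← hj, hab]
    exact Subtype.ext (BaseGaloisGroup.toBase_injective hp h1)
  have hjsmul : ∀ (h : Sen.kerCyclotomic F p) (x : CompletedAlgClosure F), (j h) • x = h • x := fun h x =>
    CompletedAlgClosure.toBase_smul_completion hp (h : absoluteGaloisGroup F) x
  -- KEY: the image of an open subgroup of `H_F` is an open subgroup of `H₀`
  have hopen : ∀ V : OpenSubgroup (Sen.kerCyclotomic F p),
      IsOpen ((V.toSubgroup.map j : Subgroup H₀) : Set H₀) := by
    intro V
    -- an `F`-finite `E` with `H_F ∩ Gal(F̄/E) ⊆ V`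
    obtain ⟨W, hW, hWV⟩ := (mem_nhds_subtype _ _ _).mp (V.isOpen.mem_nhds (one_mem V))
    rw [OneMemClass.coe_one] at hW
    obtain ⟨E, hfin, hE⟩ := (krullTopology_mem_nhds_one_iff F (AlgebraicClosure F) W).mp hW
    haveI := hfin
    -- the same field over `K₀`: finite-dimensional, its fixing subgroup in `G₀` is open
    let E' : IntermediateField F (NormedAlgClosure F) := E
    haveI : FiniteDimensional F E' := hfin
    let E₀ : IntermediateField (PadicBase F p hp) (NormedAlgClosure F) := E'.restrictScalars (PadicBase F p hp)
    have hE'K : FiniteDimensional (PadicBase F p hp) E' := FiniteDimensional.trans (PadicBase F p hp) F E'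
    haveI : FiniteDimensional (PadicBase F p hp) E₀ := hE'K
    have hE₀open : IsOpen (E₀.fixingSubgroup : Set (BaseGaloisGroup hp)) := E₀.fixingSubgroup_isOpen
    -- the open subgroup `H₀ ∩ Gal(F̄/E₀)` of `H₀` lies in the image of `V`
    refine Subgroup.isOpen_of_mem_nhds _ (g := 1) (Filter.mem_of_superset
      ((Subgroup.subgroupOf_isOpen H₀ _ hE₀open).mem_nhds (one_mem _)) ?_)
    intro g hg
    have hgfix : ∀ x : NormedAlgClosure F, x ∈ E₀ → (g : BaseGaloisGroup hp) • x = x := fun x hx =>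
      (IntermediateField.mem_fixingSubgroup_iff _ _).mp (Subgroup.mem_subgroupOf.mp hg) x hx
    -- `g` fixes `F`, hence `g = toBase σ`
    have hgF : ∀ c : F, (g : BaseGaloisGroup hp) • algebraMap F (NormedAlgClosure F) c =
        algebraMap F (NormedAlgClosure F) c := fun c =>
      hgfix _ (show algebraMap F (NormedAlgClosure F) c ∈ E' from E'.algebraMap_mem c)
    obtain ⟨σ, hσ⟩ := BaseGaloisGroup.exists_toBase_eq hp (g : BaseGaloisGroup hp) hgF
    -- `σ ∈ H_F` and `σ` fixes `E`, hence `σ ∈ V`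
    have hσH : σ ∈ Sen.kerCyclotomic F p := by
      rw [Sen.mem_kerCyclotomic_iff, ← BaseGaloisGroup.baseCyclotomicCharacter_toBase hp, hσ]
      exact g.2
    have hσW : σ ∈ W := by
      refine hE ((IntermediateField.mem_fixingSubgroup_iff _ _).mpr fun x hx => ?_)
      have h1 := hgfix (NormedAlgClosure.toAlgClosure.symm x) hx
      rw [← hσ, BaseGaloisGroup.toBase_smul] at h1
      exact h1
    have hσV : (⟨σ, hσH⟩ : Sen.kerCyclotomic F p) ∈ V := hWV (show ((⟨σ, hσH⟩ : Sen.kerCyclotomic F p) :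
      absoluteGaloisGroup F) ∈ W from hσW)
    refine Subgroup.mem_map.mpr ⟨⟨σ, hσH⟩, hσV, ?_⟩
    exact Subtype.ext hσ
  -- transport (TS1)
  refine kerCyclotomic_exists_eq_smul_sub_of_TS1 p ?_ c hc hcont
  obtain ⟨K, hK⟩ := hTS
  refine ⟨K, fun U => ?_⟩
  haveI : Fintype (Sen.kerCyclotomic F p ⧸ U.toSubgroup) := Fintype.ofFinite _
  let H₁ : OpenSubgroup H₀ := ⟨U.toSubgroup.map j, hopen U⟩
  let H₂ : OpenSubgroup H₀ := ⟨(⊤ : OpenSubgroup (Sen.kerCyclotomic F p)).toSubgroup.map j, hopen ⊤⟩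
  have h12 : H₁ ≤ H₂ := by
    intro x hx
    obtain ⟨u, -, rfl⟩ := Subgroup.mem_map.mp hx
    exact Subgroup.mem_map.mpr ⟨u, trivial, rfl⟩
  let S : Finset H₀ := Finset.univ.image fun q : Sen.kerCyclotomic F p ⧸ U.toSubgroup => j q.out
  have hS₂ : ∀ s ∈ S, s ∈ H₂ := by
    intro s hs
    obtain ⟨q, -, rfl⟩ := Finset.mem_image.mp hs
    exact Subgroup.mem_map.mpr ⟨q.out, trivial, rfl⟩
  have hmemH₁ : ∀ h : Sen.kerCyclotomic F p, j h ∈ H₁ ↔ h ∈ U := by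
    intro h
    constructor
    · intro hh
      obtain ⟨u, hu, hju⟩ := Subgroup.mem_map.mp hh
      rw [← hjinj hju]
      exact hu
    · intro hh
      exact Subgroup.mem_map.mpr ⟨h, hh, rfl⟩
  have hrep : ∀ h ∈ H₂, ∃! s, s ∈ S ∧ s⁻¹ * h ∈ H₁ := by
    intro h' hh'
    obtain ⟨h, -, rfl⟩ := Subgroup.mem_map.mp hh'
    refine ⟨j (QuotientGroup.mk h : _ ⧸ U.toSubgroup).out, ⟨?_, ?_⟩, ?_⟩
    · exact Finset.mem_image.mpr ⟨QuotientGroup.mk h, Finset.mem_univ _, rfl⟩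
    · rw [← map_inv, ← map_mul, hmemH₁]
      exact QuotientGroup.eq.mp (QuotientGroup.out_eq' (QuotientGroup.mk h : _ ⧸ U.toSubgroup))
    · rintro s ⟨hs, hsU⟩
      obtain ⟨q, -, rfl⟩ := Finset.mem_image.mp hs
      rw [← map_inv, ← map_mul, hmemH₁] at hsU
      have hq : (QuotientGroup.mk q.out : _ ⧸ U.toSubgroup) = QuotientGroup.mk h := QuotientGroup.eq.mpr hsU
      rw [QuotientGroup.out_eq'] at hq
      rw [hq]
  obtain ⟨α, hαU, hαK, hαS⟩ := hK H₁ H₂ h12 S hS₂ hrep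
  refine ⟨α, fun u hu => ?_, hαK, ?_⟩
  · rw [← hjsmul]
    exact hαU _ ((hmemH₁ u).mpr hu)
  · rw [finsum_eq_sum_of_fintype, ← hαS, Finset.sum_image]
    · exact Finset.sum_congr rfl fun q _ => (hjsmul q.out α).symm
    · intro q₁ _ q₂ _ h
      exact Quotient.out_injective (hjinj h)

end Descent

/-! ### Continuity of `log χ_cyclo` (on `Γ_F` and on `G₀`) and of `ℚ_p ≅ K₀` -/

section LogChi

open UniformSpace Field ValuativeRel
open Literature.NumberTheory.GaloisRepresentations
open Literature.NumberTheory.GaloisRepresentations.IsNonarchimedeanLocalField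

variable {F : Type} [Field F] [ValuativeRel F] [TopologicalSpace F] [IsNonarchimedeanLocalField F]
  [CharZero F]

omit [ValuativeRel F] [TopologicalSpace F] [IsNonarchimedeanLocalField F] [CharZero F] in
/-- **`log χ_cyclo : Γ_F → ℚ_p` is continuous** (Kato, LNM 1553 II §1.2.2: `log(χ_cyclo) ∈ H¹(K, ℤ_p) =
Hom_cont(Gal(K̄/K), ℤ_p)`): the cyclotomic character is continuous (Mathlib), its values are units, and
Neukirch's `log_p` is continuous on the unit sphere (tree `IUT.LogVolume.continuousOn_unitLog`).
[cite: Kato1993LNM1553, Ch. II §1.2.2] -/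
theorem continuous_logCyclotomic (p : ℕ) [Fact p.Prime] : Continuous (logCyclotomic (F := F) p) := by
  have hcoe : Continuous ((↑) : ℤ_[p] → ℚ_[p]) := continuous_subtype_val
  have hval : Continuous (fun u : ℤ_[p]ˣ => (u : ℤ_[p])) := Units.continuous_val
  have hχ : Continuous fun σ : absoluteGaloisGroup F =>
      (((GaloisRep.cyclotomicCharacter F p σ : ℤ_[p]ˣ) : ℤ_[p]) : ℚ_[p]) :=
    hcoe.comp (hval.comp (GaloisRep.cyclotomicCharacter F p).continuous)
  exact (Literature.IUT.LogVolume.continuousOn_unitLog p ℚ_[p]).comp_continuous hχ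
    fun σ => norm_coe_cyclotomicCharacter p σ

variable {p : ℕ} [Fact p.Prime] (hp : valuation F p < 1)

/-- **`log χ : G₀ → ℚ_p` is continuous at the base of the tower**: `g ↦ log_p χ(g)` for the cyclotomic character
`BaseGaloisGroup.baseCyclotomicCharacter hp` of `G₀ = Gal(F̄/K₀)` (continuity of `χ`: Mathlib's
`cyclotomicCharacter.continuous`; of `log_p` on units: tree `continuousOn_unitLog`). [cite: Kato1993LNM1553, Ch. II §1.2.2] -/
theorem continuous_unitLog_baseCyclotomicCharacter :
    Continuous fun g : BaseGaloisGroup hp =>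
      Literature.IUT.LogVolume.unitLog
        (((BaseGaloisGroup.baseCyclotomicCharacter hp g : ℤ_[p]ˣ) : ℤ_[p]) : ℚ_[p]) := by
  have hcoe : Continuous ((↑) : ℤ_[p] → ℚ_[p]) := continuous_subtype_val
  have hval : Continuous (fun u : ℤ_[p]ˣ => (u : ℤ_[p])) := Units.continuous_val
  have hχ : Continuous fun g : BaseGaloisGroup hp =>
      (((BaseGaloisGroup.baseCyclotomicCharacter hp g : ℤ_[p]ˣ) : ℤ_[p]) : ℚ_[p]) :=
    hcoe.comp (hval.comp (cyclotomicCharacter.continuous p (PadicBase F p hp) (NormedAlgClosure F)))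
  refine (Literature.IUT.LogVolume.continuousOn_unitLog p ℚ_[p]).comp_continuous hχ fun g => ?_
  change ‖(((BaseGaloisGroup.baseCyclotomicCharacter hp g : ℤ_[p]ˣ) : ℤ_[p]) : ℚ_[p])‖ = 1
  rw [PadicInt.padic_norm_e_of_padicInt]
  exact PadicInt.isUnit_iff.mp (Units.isUnit _)

/-- **The identification `ℚ_p → K₀ = PadicBase F p hp` is continuous** (`toPadic.symm`; the norm of `K₀` is
induced from `F`, so it is `‖p‖_{K₀}`-adically the `p`-adic topology: `‖pⁿ z‖_{K₀} ≤ ‖p‖_{K₀}ⁿ` for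
`z ∈ ℤ_p`). [folklore] -/
private theorem norm_toPadic_symm_pow_mul_le (n : ℕ) (z : ℤ_[p]) :
    ‖(PadicBase.toPadic hp).symm ((p : ℚ_[p]) ^ n * (z : ℚ_[p]))‖ ≤ ‖(p : PadicBase F p hp)‖ ^ n := by
  rw [map_mul, map_pow, map_natCast, norm_mul, norm_pow]
  exact mul_le_of_le_one_right (pow_nonneg (norm_nonneg _) n) (PadicBase.norm_coe_padicInt_le_one hp z)

/-- **`toPadic.symm : ℚ_p → K₀` is continuous**: the valuation topology of the closure `K₀` of `ℚ` in the
`p`-adic field `F` is the `p`-adic topology (an additive homomorphism continuous at `0`: the ball `pⁿ ℤ_p` is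
mapped into the ball of radius `‖p‖_{K₀}ⁿ`, and `‖p‖_{K₀} < 1`). [cite: SerreLocalFields1979, Ch. II §5] -/
theorem continuous_toPadic_symm : Continuous (PadicBase.toPadic hp).symm := by
  refine continuous_of_continuousAt_zero (PadicBase.toPadic hp).symm ?_
  rw [ContinuousAt, map_zero, Metric.tendsto_nhds_nhds]
  intro ε hε
  -- choose `n` with `‖p‖_{K₀}^n < ε`
  obtain ⟨n, hn⟩ := exists_pow_lt_of_lt_one hε (PadicBase.norm_p_lt_one hp)
  have hp1 : (1 : ℝ) < p := by exact_mod_cast (Fact.out : p.Prime).one_lt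
  have hδ0 : (0 : ℝ) < (p : ℝ) ^ (-(n : ℤ)) := zpow_pos (by positivity) _
  refine ⟨(p : ℝ) ^ (-(n : ℤ)), hδ0, fun {x} hx => ?_⟩
  rw [dist_zero_right] at hx ⊢
  -- `‖x‖ < p^{-n} ≤ 1`: `x = pⁿ z` with `z ∈ ℤ_p`
  have hx1 : ‖x‖ ≤ 1 := hx.le.trans (zpow_le_one_of_nonpos₀ hp1.le (by omega))
  obtain ⟨z, hz⟩ : ∃ z : ℤ_[p], x = (p : ℚ_[p]) ^ n * (z : ℚ_[p]) := by
    set x' : ℤ_[p] := ⟨x, hx1⟩ with hx'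
    have hnorm : ‖x'‖ ≤ (p : ℝ) ^ (-(n : ℤ)) := hx.le
    have hmem : x' ∈ (Ideal.span {(p : ℤ_[p]) ^ n} : Ideal ℤ_[p]) :=
      (PadicInt.norm_le_pow_iff_mem_span_pow x' n).mp hnorm
    obtain ⟨a, ha⟩ := Ideal.mem_span_singleton'.mp hmem
    refine ⟨a, ?_⟩
    have h : (((a * (p : ℤ_[p]) ^ n : ℤ_[p])) : ℚ_[p]) = x := by rw [ha]
    rw [← h]
    push_cast
    ring
  rw [hz]
  exact (norm_toPadic_symm_pow_mul_le hp n z).trans_lt hn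


/-- **`ker χ` is the subgroup of `G₀` fixing every `ζ_{p^M}`** — the bridge between the kernel form of
`H₀` used in this file and the stabiliser form `{g | ∀ M, g • ζ_{p^M} = ζ_{p^M}}` of `TateInvariantsBase`
(`fixedPoints_eq_X`) / `TateH1Reduction`. (`←`: tree `TateTrace.chi_eq_one_of_forall_smul_zeta`; `→`: the
defining property `g • ζ = ζ^{χ(g) mod p^M}`.) [cite: Tate1967, §3.1] -/
theorem mem_baseKer_iff_forall_smul_zeta (g : BaseGaloisGroup hp) :
    g ∈ (BaseGaloisGroup.baseCyclotomicCharacter hp).ker ↔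
      ∀ M : ℕ, g • CyclotomicTower.zeta F p M = CyclotomicTower.zeta F p M := by
  constructor
  · intro hg M
    rw [MonoidHom.mem_ker] at hg
    have hspec := BaseGaloisGroup.baseCyclotomicCharacter_spec hp g (CyclotomicTower.zeta F p M)
      (CyclotomicTower.zeta_spec F p M).pow_eq_one
    rw [hg, Units.val_one, map_one] at hspec
    rcases Nat.eq_zero_or_pos M with rfl | hM
    · -- `ζ_1 = 1`
      have h1 : CyclotomicTower.zeta F p 0 = 1 := by
        have := (CyclotomicTower.zeta_spec F p 0).pow_eq_one
        rwa [pow_zero, pow_one] at this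
      rw [h1, smul_one]
    · haveI : Fact (1 < p ^ M) := ⟨Nat.one_lt_pow hM.ne' (Fact.out : p.Prime).one_lt⟩
      rwa [ZMod.val_one, pow_one] at hspec
  · intro hg
    exact (MonoidHom.mem_ker).mpr (TateTrace.chi_eq_one_of_forall_smul_zeta hp hg)

end LogChi

end Literature.NumberTheory.PAdicHodge.TateSen

end
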